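import Mathlib
import HarnessLib
import HarnessLib.Audit
import Summits.KontsevichZagierPeriods.Statement
import Literature.NumberTheory.Transcendental.MZVSimplexRep
import Literature.NumberTheory.Transcendental.MultipleZetaStuffle
import Literature.NumberTheory.Transcendental.MZVWordShuffle
import HarnessLib.Audit.Status.Attr

/-!
Route: ToricCore

DORMANT since 2026-08-24T05:12:16Z (reconciler: no traction for 6.6 d (last activity item-proof-filed at 2026-08-17T15:12:54Z); parked, not closed — `ledger route dormant route-KontsevichZagierPeriods-ToricCore --off` to reactivate) — unstaffed, not closed; items shared with open routes are served there. `ledger route dormant <id> --off` reactivates.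

# Route ToricCore — MZV identities by fan combinatorics — binomial cuts, monomial maps, rational
Stokes; Euler's duality is the test

It suffices to show X = ToricKernel ∧ ToricCofinality. Let T ⊆ KZ.FormalRep be the TORIC SPAN: the
subgroup generated by the
representations [r] whose domain is a signed-binomial cell {x | ∀k, 0 < g_k(x)} ∩ {x | ∀k, 0 ≤
h_k(x)} and whose integrand agrees on it
with P(x)/∏_k d_k(x), where P ∈ ℚ[x₁,…,xₙ] and every g_k, h_k, d_k is a signed binomial u·x^a +
w·x^b (u, w ∈ {−1,0,1}, a, b ∈ ℕⁿ)
— in logarithmic coordinates: rational polyhedral cones carrying exponential-rational integrands; it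
contains every MZV simplex
representation `KZ.mzvRep s`, their cubical forms, their products, the shuffle simplices and the
Tornheim/Mordell–Witten generating
functions, and its values are (alternating) conical zeta values. ToricKernel (target): Conjecture 1
on T in kernel form — every c ∈ T
with KZ.eval c = 0 lies in KZ.relations. ToricCofinality (remainder): every c with KZ.eval c = 0 is
congruent modulo KZ.relations to an
element of T. The card's mechanism (toric-core-mzv-duality-dichotomy) lives one level down and is
what the ranked cruxes test: the
TORIC SUB-CALCULUS R_tor ⊆ KZ.relations generated by the instances of moves (1a), (1b), (3)
supported on T together with the MONOMIAL
changes of variables x ↦ (∏_j x_j^(A_ij))_i, A ∈ M_n(ℤ), det A ≠ 0, on cells inside the open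
positive orthant (Jacobian
|det A|·∏_i(∏_j x_j^(A_ij))/∏_j x_j). Finite double shuffle is toric (support); whether Euler's
duality ζ(2,1) = ζ(3) is toric is the
rank-2 dichotomy; conservativity of KZ over R_tor on T is rank 3; Hoffman's weight-4 relation is
rank 4.
Lean: `let T : AddSubgroup Literature.NumberTheory.Transcendental.KZ.FormalRep :=
AddSubgroup.closure {c | ∃ (n N M K : ℕ) (r : Literature.NumberTheory.Transcendental.KZ.IntegralRep
n) (g : Fin N → (Fin n → ℝ) → ℝ) (h : Fin M → (Fin n → ℝ) → ℝ) (d : Fin K → (Fin n → ℝ) → ℝ) (P :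
MvPolynomial (Fin n) ℚ), (∀ f ∈ Set.range g ∪ Set.range h ∪ Set.range d, ∃ (u w : SignType) (a b :
Fin n → ℕ), f = fun x => (u : ℝ) * (∏ i, x i ^ a i) + (w : ℝ) * (∏ i, x i ^ b i)) ∧ r.domain = {x |
(∀ k, 0 < g k x) ∧ ∀ k, 0 ≤ h k x} ∧ Set.EqOn r.integrand (fun x => MvPolynomial.aeval x P / ∏ k, d
k x) r.domain ∧ c = Literature.NumberTheory.Transcendental.KZ.of r}; (∀ c ∈ T,
Literature.NumberTheory.Transcendental.KZ.eval c = 0 → c ∈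
Literature.NumberTheory.Transcendental.KZ.relations) ∧ (∀ c :
Literature.NumberTheory.Transcendental.KZ.FormalRep, Literature.NumberTheory.Transcendental.KZ.eval
c = 0 → ∃ t ∈ T, c - t ∈ Literature.NumberTheory.Transcendental.KZ.relations)`

## Assembly
Pure logic (sorry-free `example : Assembly` in the planner's Sketch.lean): given c with KZ.eval c =
0, ToricCofinality gives t ∈ T with
c − t ∈ KZ.relations; soundness
(`Literature.NumberTheory.Transcendental.KZ.relations_le_ker_eval_holds`) gives eval t = 0,
ToricKernel
gives t ∈ KZ.relations, hence c = (c − t) + t ∈ KZ.relations — the kernel conjecture — and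
`Summit.KontsevichZagierPeriods.KernelForm.kontsevichZagierPeriods_of_kzKernelConjecture`
(Theorems/KernelFormKernelImpliesStatement.lean)
gives the summit. Logical status: Summit ⇒ ToricKernel and Summit ⇒ ToricCofinality trivially, so X
⇔ KZKernelConjecture; the split is by
SECTOR (conical / mixed-Tate versus the rest). The ranked cruxes refine the sector side by
restricting the MOVES to R_tor, and ToricSound
turns every toric chain into a KZ chain, so each positive crux lands in KZ.relations as well.

Rationale: WHY THIS LINE. Every representation anyone has actually manipulated in the MZV sector is toric in
the above sense (the ordered simplex is a binomial
cell, ∏ω_ε(tᵢ) a Laurent–binomial function; cubical coordinates tᵢ = x₀⋯xᵢ are a unimodular monomial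
map), and every move actually
used there is a binomial cut, an integrand partial fraction, an integer monomial map or
Newton–Leibniz with a RATIONAL primitive: on
the discrete side these are exactly the cone subdivisions and GL_n(ℤ)-reindexings of conical zeta
values (GuoPaychaZhang2014,
arXiv:1301.3370, whose double subdivision relations contain double shuffle; arXiv:math/0410306,
cones ↔ cyclotomic MZVs) and
Soudères' cubical stuffle geometry (Souderes2010, arXiv:0808.0248; BrownCarrSchneps2010 for cell
forms). The route names this
sub-calculus R_tor INSIDE the fixed H21 calculus, files the finite double shuffle and W(1,1,1) =
2ζ(2,1) (Tornheim1950) as toric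
chains, and asks the question the restriction makes decidable in bounded form: is Euler's duality
ζ(2,1) = ζ(3) — the smallest MZV
relation that is neither a finite stuffle nor a finite shuffle, classically the affine reflection t
↦ 1−t of the simplex (route
CoactionDevissage item Duality) or a shift-telescoping of divergent harmonic sums
(BorweinBradley2006 collects 32 proofs) —
derivable by toric moves? YES is the first reflection-free, regularisation-free chain for a
duality/Hoffman-type relation and
opens Dehn–Shintani-type GL_n(ℤ)-cocycle invariants on the sector; NO is the first internal
rule-elimination theorem of the calculus
in dimension three ("a non-monomial move is needed"), with its separating invariant as technology
for route Neg. Imported areas: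
toric/polyhedral combinatorics (fans, unimodular and integer monomial maps, Brion–Vergne cone
decompositions), conical zeta values and
their subdivision relations from the renormalisation school, quasi-shuffle combinatorics
(Hoffman1997, IharaKanekoZagier2006) —
all pointed at the PROOF relation `KZ.relations`, not at values or motives. What prior routes and
the (empty) negatives index do not
do: Grothendieck 0275, CoactionDevissage (Stuffle, Shuffle, Duality, HoffmanRegularisation) and
StandardParts (SpHoffmanWeightFour)
ask for membership in KZ.relations with all semialgebraic moves allowed; this line restricts the
MOVES, proves the finite double
shuffle inside the restriction, and recasts "rules versus motives on MT(ℤ)" as conservativity of KZ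
over a finitely presented
combinatorial calculus whose first instance is a finite search.

RANKED CRUXES. #0 ToricKernel (target) — Conjecture 1 on the toric span, kernel form: every
ℤ-combination of toric representations (signed-binomial cells, Laurent–binomial integrands) whose
value is 0 lies in KZ.relations. The sector the toric engine is for; together with ToricCofinality
it is X. (why it might fail: Period-conjecture strength on the conical/cyclotomic mixed-Tate sector:
false as soon as the four moves miss one motivic MZV relation (HuberMullerStach2017 Rem. 13.1.8,
route Neg) or a non-motivic Z-relation among conical zeta values exists.) [KontsevichZagier2001,
HuberMullerStach2017, GuoPaychaZhang2014, Terasoma2002, arXiv:math/0410306]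
#2 DualityWeightThreeToric (crux) — Euler's duality in cubical form is TORIC: for representations r
= [□³, x₀x₁/((1−x₀x₁)(1−x₀x₁x₂))] (= ζ(2,1)) and r' = [□³, 1/(1−x₀x₁x₂)] (= ζ(3)) on the open unit
cube, [r] − [r'] ∈ R_tor. This is the card's dichotomy item: in KZ.relations the difference is
derivable (CubicalCoordinates + the simplex reflection tᵢ ↦ 1−t₂₋ᵢ); the question is whether
binomial cuts, integer monomial maps, partial fractions and rational Stokes suffice. Equivalent
toric forms: W(1,1,1)-rep S ~ 2·Z₃; S ~ U := [□³, 1/((1−x₁x₂)(1−x₀x₁x₂))] (U = Z₃ + Z₂₁ as rational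
functions). [difficulty: M] (why it might fail: Duality may genuinely need the non-monomial
reflection t↦1−t: weight 3 has no finite double-shuffle relation, Euler's proof shift-telescopes
Σ(1/m−1/(m+n)), 'double shuffle ⇒ duality' is open (arXiv:1512.00753 p.3); a Mellin-residue/depth
invariant of toric moves may separate Z21, Z3.) [BorweinBradley2006, Tornheim1950, arXiv:1512.00753,
doi:10.1016/j.jnt.2006.01.001, IharaKanekoZagier2006, GuoPaychaZhang2014, Zagier1994]
#3 ToricCoreConservativity (crux) — KZ is conservative over the toric sub-calculus on the toric
span: every c ∈ T that lies in KZ.relations already lies in R_tor — every KZ-chain between toric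
data can be replaced by binomial cuts, partial fractions, integer monomial maps and rational Stokes.
Transcendence-free; with ToricKernel it says the conical sector of Conjecture 1 is decided by fan
combinatorics (the card's Toric Core conjecture). [deps: DualityWeightThreeToric] [difficulty:
open-problem] (why it might fail: Its first instance is DualityWeightThreeToric; general KZ-chains
pass through non-toric cells (affine cuts t<1/2, reflections, algebraic CoV) and R_tor may lack
distribution/regularisation-type relations — one KZ-equivalent toric pair separated by an
R_tor-invariant kills it.) [KontsevichZagier2001, GuoPaychaZhang2014, arXiv:1602.04190,
arXiv:math/0410306, Souderes2010]
#4 HoffmanWeightFourToric (crux) — Hoffman's relation at s = (3), ζ(4) = ζ(3,1) + ζ(2,2), is toric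
in cubical form: for reps on the open cube □⁴ with integrands 1/(1−x₀x₁x₂x₃),
x₀x₁x₂/((1−x₀x₁x₂)(1−x₀x₁x₂x₃)) and x₀x₁/((1−x₀x₁)(1−x₀x₁x₂x₃)), [Z₄] − [Z₃₁] − [Z₂₂] ∈ R_tor — the
one weight-4 relation not generated by finite double shuffle and duality; through ToricSound and
CubicalCoordinates a toric chain here also closes StandardParts.SpHoffmanWeightFour and the s = (3)
instance of CoactionDevissage.HoffmanRegularisation. [deps: DualityWeightThreeToric] [difficulty: L]
(why it might fail: All printed proofs regularise ζ(1)ζ(3) or telescope n↦n+m (Hoffman1992 Thm 5.1,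
IharaKanekoZagier2006); in R_tor only rational Stokes ∂_z(P/∏(1−m·z)^e) can play that role, and an
invariant refuting DualityWeightThreeToric should refute this too.) [Hoffman1992,
IharaKanekoZagier2006, Zagier1994, arXiv:0808.0248]
#5 ToricCofinality (crux) — every vanishing formal combination c (KZ.eval c = 0) is congruent modulo
KZ.relations to an element of the toric span T. Summit-implied (t := 0); given ToricKernel it is
exactly Conjecture 1 off the conical sector — the honest remainder, split off by SECTOR so that the
assembly is pure logic. [difficulty: open-problem] (why it might fail: It carries the whole
non-mixed-Tate part of Conjecture 1 (elliptic/CM periods, Legendre's relation, Gamma values):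
summit-implied (t := 0) but, given ToricKernel, equivalent to the summit off the conical sector; no
toric engine reaches it and route Neg's witnesses would live there.) [KontsevichZagier2001,
HuberMullerStach2017, Ayoub2014]
#9 TornheimToric (support) — (card T1) W(1,1,1) = Σ 1/(mn(m+n)) as S = [□³, x₂/((1−x₀x₂)(1−x₁x₂))]
satisfies [S] − 2·[Z₂₁] ∈ R_tor with Z₂₁ = [□³, x₀x₁/((1−x₀x₁)(1−x₀x₁x₂))] (= ζ(2,1)): one binomial
cut □³ = {x₀<x₁} ⊔ {x₁≤x₀} (the diagonal is a null toric cell, removable inside R_tor by the r = r ∪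
r instance of (1a)), the monomial maps (y₀,y₁,y₂) ↦ (y₀y₁, y₁, y₂) resp. (y₀, y₀y₁, y₂) (det 1,
Jacobian y₁ resp. y₀) and a coordinate permutation; integrands transform exactly (checked by hand
and by series). Calibration of the inline encoding: prove first. [difficulty: provable-now]
[Tornheim1950, BorweinBradley2006, KontsevichZagier2001]
#9 CubicalCoordinates (support) — the simplex representation is toric-equivalent to its cubical
form: for admissible s of weight w and any rep r on the open cube □^w with integrand mzvIntegrand s
(x₀, x₀x₁, …, x₀⋯x_(w−1)) · ∏_j x_j^(w−1−j), [mzvRep s] − [r] ∈ R_tor — ONE monomial change of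
variables (A_ij = 1 for j ≤ i, det 1, image of □^w = the open ordered simplex, Jacobian ∏_j
x_j^(w−1−j)); both representations are toric as data (StrictAnti ⟺ finitely many binomial
inequalities; ∏ ω_ε = 1/∏(signed binomials)). [difficulty: provable-now] [arXiv:0808.0248,
Souderes2010, Brown2012, KontsevichZagier2001]
#9 FiniteStuffleToric (support) — (card T2) for admissible s, t: [mzvRep s]·[mzvRep t] − Σ_(u ∈
stuffle s t) [mzvRep u] ∈ R_tor — cubical coordinates on both factors (block-diagonal monomial map),
the order-type partial fraction 1/((1−X)(1−Y)) = 1/(1−XY) + X/((1−X)(1−XY)) + Y/((1−Y)(1−XY)) (all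
summands positive, hence absolutely integrable: integrand additivity inside T) iterated along
Hoffman's recursion, and block permutations. Strengthens CoactionDevissage.Stuffle (same statement
in KZ.relations) through ToricSound. [difficulty: L] [Hoffman1997, Souderes2010, arXiv:0808.0248,
GuoPaychaZhang2014]
#9 FiniteShuffleToric (support) — for admissible s, t: [mzvRep s]·[mzvRep t] − Σ_(w ∈ sh(word s,
word t)) [mzvRep (index of w)] ∈ R_tor — the product domain Δ_p × Δ_q is a binomial cell, its
dissection into the simplices indexed by shuffles is by binomial cuts tᵢ ≶ s_j (pairwise overlaps
null) and the identifications are coordinate permutations. Strengthens CoactionDevissage.Shuffle;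
with FiniteStuffleToric it puts Grothendieck 0275 (ζ(4) = 4ζ(3,1)) inside R_tor. [difficulty: L]
[arXiv:0808.0248, BrownCarrSchneps2010, KontsevichZagier2001]
#9 ToricSound (support) — R_tor ≤ KZ.relations: the support-toric instances of (1a), (1b), (3) are
moves by definition, and a monomial map x ↦ (∏_j x_j^(A_ij))_i with det A ≠ 0 on a domain inside the
open positive orthant is ℚ-semialgebraic, differentiable and injective with |det D| = |det
A|·∏_i(∏_j x_j^(A_ij))/∏_j x_j, so every monomial instance is a changeOfVariablesRel instance. Makes
each toric item imply its KZ.relations shadow (e.g. FiniteStuffleToric ⇒ CoactionDevissage.Stuffle,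
HoffmanWeightFourToric + CubicalCoordinates ⇒ StandardParts.SpHoffmanWeightFour). [difficulty:
provable-now] [KontsevichZagier2001,
Literature.NumberTheory.Transcendental.KZ.changeOfVariablesRel_subset_relations]

TWO-LAYER PLAN. Foreseen glued splits, none filed now. If DualityWeightThreeToric looks YES:
DualityWeightThreeToric ⇐ RationalStokesStep (the ∂_z-exact
toric instances on □³-bands needed) → ExplicitToricChainW3 → DualityWeightThreeToric, then
HoffmanWeightFourToric by the same template
one weight up. If a bounded search says NO up to (degree, length) = (3, 8): file
¬DualityWeightThreeToric ⇐ ToricMellinInvariant (an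
additive invariant of the toric span, e.g. the class of the multivariate Mellin transform M_r(s)
modulo the linear action of toric
moves: GL_n(ℤ) substitutes s, cuts/additivity add, rational Stokes shifts and multiplies by linear
forms) → InvariantSeparates
(ℚ(s)-rational residues of M_Z₃ along polar families versus digamma-valued residues of M_Z₂₁) →
¬DualityWeightThreeToric.
ToricCoreConservativity ⇐ weight-graded MZV instances (w ≤ 5) → a normal form for toric chains (fans
+ Smith normal form of A) →
ToricCoreConservativity (k ≤ 3, depth 1 each).

KILL CRITERIA. ¬DualityWeightThreeToric proved (a toric invariant separating Z₂₁ from Z₃) also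
refutes ToricCoreConservativity (Z₂₁ − Z₃ ∈
KZ.relations ∩ T by CubicalCoordinates + the simplex reflection) and moots HoffmanWeightFourToric:
the negative theorem is banked as
the first rule-elimination lower bound of the calculus in dimension 3, and the route PIVOTS by one
restate — R_tor enlarged by the
hyperoctahedral reflections xᵢ ↦ 1−xᵢ of the cube — keeping X, ToricKernel and the support items (X
does not mention R_tor). ToricKernel
refuted (an additive invariant of FormalRep vanishing on all four move sets and separating two
equal-valued toric representations, the
shape of Neg 0313) refutes KZKernelConjecture and the summit outright: close `refuted:ToricKernel`,
hand the witness to route Neg.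
ToricCofinality can only fail together with the summit. TornheimToric or CubicalCoordinates turning
out UNPROVABLE as typed signals a
defect of the inline toric encoding, not of the line: restate every item over the requested
definitions. Superseded on its positive
side if CoactionDevissage.HoffmanSpan lands for all s by non-toric chains and
ToricCoreConservativity is refuted.

NOT DECOMPOSED YET. The general conical sector (cyclotomic levels from dilations x ↦ x^N,
alternating signs, unbounded cones) and distribution relations as a
relation family; higher-weight duality and the full Hoffman family inside R_tor; the invariant
technology of the negative branch (Mellin
transforms, Shintani/Eisenstein cocycles on GL_n(ℤ)); Tornheim/Mordell–Witten families W(r,s,t)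
beyond (1,1,1); the compact restatement
of all items over `KZ.toricSpan` / `KZ.toricRelations` once the definition request lands (tenure
edit, meaning unchanged); a kit
search engine for bounded toric chains (exact rational-function and polyhedral arithmetic).

CHEAPEST FALSIFIER. (1) Prove TornheimToric — three explicit toric moves, a day of Lean: if the
inline encoding of T / R_tor blocks it, the encoding (not the
line) is wrong and every item gets restated. (2) The card's bounded toric search: enumerate toric
chains between S = [□³,
x₂/((1−x₀x₂)(1−x₁x₂))] and U = [□³, 1/((1−x₁x₂)(1−x₀x₁x₂))] (both 2ζ(3); U = Z₃ + Z₂₁ exactly, S ~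
2Z₂₁ by T1) with binomial degree ≤ 2,
matrix entries ≤ 2 in absolute value, ≤ 6 moves, exact arithmetic — a kit job whose CONTROL must
recover the 3-move Tornheim chain and
the weight-4 finite double shuffle; not run in this one-shot plancard unit. (3) Lookup: scan the 32
proofs of ζ(2,1) = ζ(3) in
BorweinBradley2006 for one that uses only partial fractions, integer reindexing and rational
telescoping of absolutely convergent
multiple integrals/sums — such a proof transcribes into a toric chain and settles
DualityWeightThreeToric positively at once.

NUMBERS. ζ(3) = 1.2020569…; ζ(2,1) = ζ(3) (Euler 1775); W(1,1,1) = Σ_(m,n≥1) 1/(mn(m+n)) = 2ζ(3) =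
2.4041138… (Tornheim1950); Σ_n H_n/n² = 2ζ(3)
= ζ(3) + ζ(2,1); exact integrand identity 1/((1−yz)(1−xyz)) = 1/(1−xyz) + yz/((1−yz)(1−xyz)). Weight
4: ζ(4) = π⁴/90, ζ(3,1) = ζ(4)/4,
ζ(2,2) = 3ζ(4)/4, ζ(2,1,1) = ζ(4); finite double shuffle yields only ζ(4) = 4ζ(3,1); Hoffman at s =
(3) yields ζ(4) = ζ(3,1) + ζ(2,2).
Cubical integrands (checked by series expansion this session; cubical Jacobian ∏_j x_j^(w−1−j)): Z₃
= 1/(1−x₀x₁x₂),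
Z₂₁ = x₀x₁/((1−x₀x₁)(1−x₀x₁x₂)), S = x₂/((1−x₀x₂)(1−x₁x₂)) = Σ x₀^a x₁^b x₂^(a+b+1), Z₄ =
1/(1−x₀x₁x₂x₃),
Z₃₁ = x₀x₁x₂/((1−x₀x₁x₂)(1−x₀x₁x₂x₃)), Z₂₂ = x₀x₁/((1−x₀x₁)(1−x₀x₁x₂x₃)). Zagier dimensions d_3 = 1,
d_4 = 1. Items at open: 11
(1 target, 4 cruxes, 5 support, 1 assembly); every Lean statement elaborated (lean check rc 0, 0
sorries, 2026-08-15).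

DEFINITION REQUESTS. ToricSpan / ToricRelations (topic
Summits/KontsevichZagierPeriods/KontsevichZagierPeriods/Theorems — objects posited for this
problem):
`KZ.toricSpan : AddSubgroup KZ.FormalRep` := the first `let` of every item (signed-binomial cells,
Laurent–binomial integrands) and
`KZ.toricRelations : AddSubgroup KZ.FormalRep` := the second `let` (support-toric instances of
domainAddRel ∪ integrandAddRel ∪
newtonLeibnizRel, plus the monomial change-of-variables instances), verbatim from the planner's
Sketch.lean (`toricSpanSketch`,
`toricRelSketch`), with the API: `of_mem_toricSpan_iff` (a generator [r] lies in the span iff r is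
toric — free-abelian support),
`toricRelations_le_relations` (= ToricSound), `mzvRep_mem_toricSpan`, `prod_mem_toricSpan`,
`restrict_binomial_mem_toricSpan`. After it
lands every item is restated as a short Prop over these constants (tenure; meaning unchanged). No
Literature fact enters as a hypothesis:
`mzvIntegrand_isSemialgebraicFunOn_holds`, `mzvIntegrand_integrableOn_holds`,
`prodFunSemialgebraic_holds`, `relations_le_ker_eval_holds`
are proved. Literature wanted (acquisition filed): Kajikawa 2006, Duality and double shuffle
relations of MZVs (doi:10.1016/j.jnt.2006.01.001, acq-02339) for the exact scope of
"double shuffle ⇒ duality" in depth 2.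

Novelty: Searches (2026-08-15): `lit search --hybrid "conical zeta values cone subdivision double shuffle
multiple zeta"` (10 held docs: Eie 2008,
Aoki 2010 proceedings, Borwein–Bailey 2004 — MZV/Tornheim background, nothing on restricted moves);
`lit search --source zbmath "conical
zeta values"` (10: GuoPaychaZhang2014 = arXiv:1301.3370, arXiv:1602.04190 renormalised conical zeta
values, Clavier–Guo–Paycha–Zhang
locality papers arXiv:1711.00884, arXiv:1810.03210); `lit search --source zbmath "duality double
shuffle multiple zeta values"` (12:
doi:10.1016/j.jnt.2006.01.001 (Kajikawa 2006), arXiv:1512.00753, BrownCarrSchneps2010 =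
arXiv:0910.0122, arXiv:1412.8044, arXiv:1801.03807, arXiv:1703.03956,
arXiv:1109.3786); `lit search --source zbmath "Tornheim double series evaluation"` (7: Espinosa–Moll
arXiv:math/0505647, Borwein–Dilcher
2018, Tsumura 2003/2004); `lit read arxiv:1512.00753 --pages 1-3` (p. 3: the relation between
duality and the double shuffle structure
"is part of a class of important open problems"); `lit read doi:10.1016/j.jnt.2006.01.001`
(paywalled → acq-02339); `lit frontier
KontsevichZagierPeriods --since 2020` (30 rows: doi:10.5802/jep.335 log corners, "A polynomial basis
for the stuffle algebra" 2026,
arXiv:2302.07650 — none restricts the KZ moves); `lit bridges KontsevichZagierPeriods --cross any`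
(30, none relevant); `lit galaxy
search "conical zeta values" --star all` and `"Tornheim double series" --star all` (galaxyd
saturated at 11:25Z, 0 rows — recorded, not  [refs: 10.1016/j.jnt.2006.01.001, 10.1016/j.jnt.2006.01.001`, 10.5802/jep.335, 10.1016/j.aim.2013.10.022, 1301.3370, 1602.04190, 1711.00884, 1810.03210, 1512.00753, 0910.0122, 1412.8044, 1801.03807, 1703.03956, 1109.3786, math/0505647, 2302.07650, math/0410306, 0808.0248, doi:10.1016/j.jnt.2006.01.001, arxiv:1512.00753, doi:10.5802/jep.335, doi:10.1016/j.aim.2013.10.022, GuoPaychaZhang2014, BrownCarrSchn]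

Barriers (technique_class: toric-subcalculus, cone-subdivision, monomial-maps): - technique_class: toric-subcalculus, cone-subdivision, monomial-maps
- Literature.Barriers.KontsevichZagierPeriods.noSemialgebraicPrimitive_inv_sub_two: evaded by
construction — R_tor's Newton–Leibniz instances are supported on toric data, so their primitives are
rational up to a function of the base (an algebraic antiderivative of a rational function is
rational), and no item integrates a 1/(t − 2)-type form in its last variable; where a transcendental
primitive would be needed (∫ dz/(1−xyz) = −log(1−xy)/(xy)) the route ASKS whether cuts + monomial
maps + rational Stokes suffice (DualityWeightThreeToric) instead of assuming it.
- Literature.Barriers.KontsevichZagierPeriods.kzConjecture_implies_oddZetaAlgIndep: not engaged by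
the cruxes of rank 2–4 or the support items — they assert (toric) derivability of relations whose
real values are already proved equal in the tree (duality, stuffle, shuffle, Hoffman's relation,
Tornheim's evaluation) and prove no independence; it bites on the target ToricKernel
(period-conjecture strength on the mixed-Tate/conical sector, conceded in its why-might-fail) and on
ToricCofinality only through the summit.
- Literature.Barriers.KontsevichZagierPeriods.kzConjecture_implies_twoPiI_log_algIndep: same — only
the target/remainder pair has that strength (π = ∫_ℝ dx/(1+x²) and log 2 = ∫₀¹ dx/(1+x) are values
of toric representations, so for q = 2 ToricKernel already carries it); conceded there, absent from
the ranked cruxes.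
- Literature.Barriers.K

History (route lifecycle, newest last):
- 2026-08-15T16:37:21Z · rev 2: restated FiniteStuffleToric (stmt-KontsevichZagierPeriods-7840), FiniteShuffleToric (stmt-KontsevichZagierPeriods-7841) — route-repair(cone) gen1: payload listed 0 of 4 'unproved cone facts'; gate deps live = 0/52 unproved, staffable, closes OK. Reconstructed the 4: either predicat (planner-rrepair-KontsevichZagierPeriods-ToricC-64bc641f-0)
- 2026-08-16T02:18:21Z · AUTO-CRUX: 1 conjecture-grade item(s) promoted to crux (ToricKernel) — refuter vetting / tiering apply (operator:999:1362873)
- 2026-08-16T04:09:45Z · AUTO-CRUX (backfill): ToricKernel — hypotheses of the deciding theorem that nothing in the route derives are cruxes (operator:999:1085951)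
- 2026-08-24T05:12:16Z · DORMANT — reconciler: no traction for 6.6 d (last activity item-proof-filed at 2026-08-17T15:12:54Z); parked, not closed — `ledger route dormant route-KontsevichZagierPer (operator:999:3180956)

sub-problem: KontsevichZagierPeriods · status: dormant · opened planner-plancard-KontsevichZagierPeriods-Kont-4c4b4c69-0 2026-08-15T12:18:58Z · rev 3 · ledger route-KontsevichZagierPeriods-ToricCore
GENERATED by the gate from the ledger (D-0016/17). Provers cite these decls: `theorem foo : Summit.KontsevichZagierPeriods.KontsevichZagierPeriods.Theses.ToricCore.<Decl> := …` in Summits/KontsevichZagierPeriods/KontsevichZagierPeriods/Theorems/<Name>.lean.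
-/

namespace Summit.KontsevichZagierPeriods.KontsevichZagierPeriods.Theses.ToricCore

open scoped BigOperators Topology Manifold Classical MeasureTheory ProbabilityTheory Matrix InnerProductSpace ComplexConjugate ContinuousMap
open Filter Set Function TopologicalSpace MeasureTheory

attribute [summit_statement] _root_.KontsevichZagierPeriods

open Literature Periods

/-- item stmt-KontsevichZagierPeriods-7833 · crux (kind.auto-crux: conjecture-grade) · rank 0 · open · by planner
why it might fail: Period-conjecture strength on the conical/cyclotomic mixed-Tate sector: false as soon as the four moves miss one motivic MZV relation (HuberMullerStach2017 Rem. 13.1.8, route Neg) or a non-motivic Z-relation among conical zeta values exists.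
sources: KontsevichZagier2001, HuberMullerStach2017, GuoPaychaZhang2014, Terasoma2002, arXiv:math/0410306
[target] Conjecture 1 on the toric span, kernel form: every ℤ-combination of toric representations
(signed-binomial cells, Laurent–binomial integrands) whose value is 0 lies in KZ.relations. The
sector the toric engine is for; together with ToricCofinality it is X. -/
@[route_item "route-KontsevichZagierPeriods-ToricCore", crux]
def ToricKernel : Prop :=
  let T : AddSubgroup Literature.NumberTheory.Transcendental.KZ.FormalRep := AddSubgroup.closure {c | ∃ (n N M K : ℕ) (r : Literature.NumberTheory.Transcendental.KZ.IntegralRep n) (g : Fin N → (Fin n → ℝ) → ℝ) (h : Fin M → (Fin n → ℝ) → ℝ) (d : Fin K → (Fin n → ℝ) → ℝ) (P : MvPolynomial (Fin n) ℚ), (∀ f ∈ Set.range g ∪ Set.range h ∪ Set.range d, ∃ (u w : SignType) (a b : Fin n → ℕ), f = fun x => (u : ℝ) * (∏ i, x i ^ a i) + (w : ℝ) * (∏ i, x i ^ b i)) ∧ r.domain = {x | (∀ k, 0 < g k x) ∧ ∀ k, 0 ≤ h k x} ∧ Set.EqOn r.integrand (fun x => MvPolynomial.aeval x P / ∏ k,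 d k x) r.domain ∧ c = Literature.NumberTheory.Transcendental.KZ.of r}; ∀ c ∈ T, Literature.NumberTheory.Transcendental.KZ.eval c = 0 → c ∈ Literature.NumberTheory.Transcendental.KZ.relations

/-- item stmt-KontsevichZagierPeriods-7834 · crux · rank 2 · open · by planner
why it might fail: Duality may genuinely need the non-monomial reflection t↦1−t: weight 3 has no finite double-shuffle relation, Euler's proof shift-telescopes Σ(1/m−1/(m+n)), 'double shuffle ⇒ duality' is open (arXiv:1512.00753 p.3); a Mellin-residue/depth invariant of toric moves may separate Z21, Z3.
sources: BorweinBradley2006, Tornheim1950, arXiv:1512.00753, doi:10.1016/j.jnt.2006.01.001, IharaKanekoZagier2006, GuoPaychaZhang2014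
[crux] Euler's duality in cubical form is TORIC: for representations r = [□³,
x₀x₁/((1−x₀x₁)(1−x₀x₁x₂))] (= ζ(2,1)) and r' = [□³, 1/(1−x₀x₁x₂)] (= ζ(3)) on the open unit cube,
[r] − [r'] ∈ R_tor. This is the card's dichotomy item: in KZ.relations the difference is derivable
(CubicalCoordinates + the simplex reflection tᵢ ↦ 1−t₂₋ᵢ); the question is whether binomial cuts,
integer monomial maps, partial fractions and rational Stokes suffice. Equivalent toric forms:
W(1,1,1)-rep S ~ 2·Z₃; S ~ U := [□³, 1/((1−x₁x₂)(1−x₀x₁x₂))] (U = Z₃ + Z₂₁ as rational functions).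
[difficulty: M] -/
@[route_item "route-KontsevichZagierPeriods-ToricCore"]
def DualityWeightThreeToric : Prop :=
  let T : AddSubgroup Literature.NumberTheory.Transcendental.KZ.FormalRep := AddSubgroup.closure {c | ∃ (n N M K : ℕ) (r : Literature.NumberTheory.Transcendental.KZ.IntegralRep n) (g : Fin N → (Fin n → ℝ) → ℝ) (h : Fin M → (Fin n → ℝ) → ℝ) (d : Fin K → (Fin n → ℝ) → ℝ) (P : MvPolynomial (Fin n) ℚ), (∀ f ∈ Set.range g ∪ Set.range h ∪ Set.range d, ∃ (u w : SignType) (a b : Fin n → ℕ), f = fun x => (u : ℝ) * (∏ i, x i ^ a i) + (w : ℝ) * (∏ i, x i ^ b i)) ∧ r.domain = {x | (∀ k, 0 < g k x) ∧ ∀ k, 0 ≤ h k x} ∧ Set.EqOn r.integrand (fun x => MvPolynomial.aeval x P / ∏ k, d k x) r.domain ∧ c = Literature.NumberTheory.Transcendental.KZ.of r}; let R : AddSubgroup Literature.NumberTheory.Transcendental.KZ.FormalRep := AddSubgroup.closure (((Literature.NumberTheory.Transcendental.KZ.domainAddRel ∪ Literature.NumberTheory.Transcendental.KZ.integrandAddRel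 ∪ Literature.NumberTheory.Transcendental.KZ.newtonLeibnizRel) ∩ (T : Set Literature.NumberTheory.Transcendental.KZ.FormalRep)) ∪ {c | ∃ (n : ℕ) (r r' : Literature.NumberTheory.Transcendental.KZ.IntegralRep n) (A : Matrix (Fin n) (Fin n) ℤ), Literature.NumberTheory.Transcendental.KZ.of r ∈ T ∧ Literature.NumberTheory.Transcendental.KZ.of r' ∈ T ∧ A.det ≠ 0 ∧ (∀ x ∈ r.domain, ∀ i, 0 < x i) ∧ r'.domain = (fun x i => ∏ j, x j ^ A i j) '' r.domain ∧ (∀ x ∈ r.domain, r.integrand x = r'.integrand (fun i => ∏ j, x j ^ A i j) * (|(A.det : ℝ)| * (∏ i, ∏ j, x j ^ A i j) / ∏ j, x j)) ∧ c = Literature.NumberTheory.Transcendental.KZ.of r - Literature.NumberTheory.Transcendental.KZ.of r'}); ∀ (r r' : Literature.NumberTheory.Transcendental.KZ.IntegralRep 3), r.domain = {x | ∀ i, 0 < x i ∧ x i < 1} → Set.EqOn r.integrand (fun x => x 0 * x 1 / ((1 - x 0 * x 1) * (1 - x 0 * x 1 * x 2))) r.domain → r'.domain = {x | ∀ i, 0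 < x i ∧ x i < 1} → Set.EqOn r'.integrand (fun x => 1 / (1 - x 0 * x 1 * x 2)) r'.domain → Literature.NumberTheory.Transcendental.KZ.of r - Literature.NumberTheory.Transcendental.KZ.of r' ∈ R

/-- item stmt-KontsevichZagierPeriods-7835 · crux · rank 3 · open · by planner
why it might fail: Its first instance is DualityWeightThreeToric; general KZ-chains pass through non-toric cells (affine cuts t<1/2, reflections, algebraic CoV) and R_tor may lack distribution/regularisation-type relations — one KZ-equivalent toric pair separated by an R_tor-invariant kills it.
sources: KontsevichZagier2001, GuoPaychaZhang2014, arXiv:1602.04190, arXiv:math/0410306, Souderes2010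
[crux] KZ is conservative over the toric sub-calculus on the toric span: every c ∈ T that lies in
KZ.relations already lies in R_tor — every KZ-chain between toric data can be replaced by binomial
cuts, partial fractions, integer monomial maps and rational Stokes. Transcendence-free; with
ToricKernel it says the conical sector of Conjecture 1 is decided by fan combinatorics (the card's
Toric Core conjecture). [deps: DualityWeightThreeToric] [difficulty: open-problem] -/
@[route_item "route-KontsevichZagierPeriods-ToricCore"]
def ToricCoreConservativity : Prop :=
  let T : AddSubgroup Literature.NumberTheory.Transcendental.KZ.FormalRep := AddSubgroup.closure {c | ∃ (n N M K : ℕ) (r : Literature.NumberTheory.Transcendental.KZ.IntegralRep n) (g : Fin N → (Fin n → ℝ) → ℝ) (h : Fin M → (Fin n → ℝ) → ℝ) (d : Fin K → (Fin n → ℝ) → ℝ) (P : MvPolynomial (Fin n) ℚ), (∀ f ∈ Set.range g ∪ Set.range h ∪ Set.range d, ∃ (u w : SignType) (a b : Fin n → ℕ), f = fun x => (u : ℝ) * (∏ i, x i ^ a i) + (w : ℝ) * (∏ i, x i ^ b i)) ∧ r.domain = {x | (∀ k, 0 < g k x) ∧ ∀ k, 0 ≤ h k x} ∧ Set.EqOn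 r.integrand (fun x => MvPolynomial.aeval x P / ∏ k, d k x) r.domain ∧ c = Literature.NumberTheory.Transcendental.KZ.of r}; let R : AddSubgroup Literature.NumberTheory.Transcendental.KZ.FormalRep := AddSubgroup.closure (((Literature.NumberTheory.Transcendental.KZ.domainAddRel ∪ Literature.NumberTheory.Transcendental.KZ.integrandAddRel ∪ Literature.NumberTheory.Transcendental.KZ.newtonLeibnizRel) ∩ (T : Set Literature.NumberTheory.Transcendental.KZ.FormalRep)) ∪ {c | ∃ (n : ℕ) (r r' : Literature.NumberTheory.Transcendental.KZ.IntegralRep n) (A : Matrix (Fin n) (Fin n) ℤ), Literature.NumberTheory.Transcendental.KZ.of r ∈ T ∧ Literature.NumberTheory.Transcendental.KZ.of r' ∈ T ∧ A.det ≠ 0 ∧ (∀ x ∈ r.domain, ∀ i, 0 < x i) ∧ r'.domain = (fun x i => ∏ j, x j ^ A i j) '' r.domain ∧ (∀ x ∈ r.domain, r.integrand x = r'.integrand (fun i => ∏ j, x j ^ A i j) * (|(A.det : ℝ)| * (∏ i, ∏ j, x j ^ A i j) / ∏ j, x j)) ∧ c = Literature.NumberTheory.Transcendental.KZ.of r - Literature.NumberTheory.Transcendental.KZ.of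 r'}); ∀ c ∈ T, c ∈ Literature.NumberTheory.Transcendental.KZ.relations → c ∈ R

/-- item stmt-KontsevichZagierPeriods-7836 · crux · rank 4 · open · by planner
why it might fail: All printed proofs regularise ζ(1)ζ(3) or telescope n↦n+m (Hoffman1992 Thm 5.1, IharaKanekoZagier2006); in R_tor only rational Stokes ∂_z(P/∏(1−m·z)^e) can play that role, and an invariant refuting DualityWeightThreeToric should refute this too.
sources: Hoffman1992, IharaKanekoZagier2006, Zagier1994, arXiv:0808.0248
[crux] Hoffman's relation at s = (3), ζ(4) = ζ(3,1) + ζ(2,2), is toric in cubical form: for reps on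
the open cube □⁴ with integrands 1/(1−x₀x₁x₂x₃), x₀x₁x₂/((1−x₀x₁x₂)(1−x₀x₁x₂x₃)) and
x₀x₁/((1−x₀x₁)(1−x₀x₁x₂x₃)), [Z₄] − [Z₃₁] − [Z₂₂] ∈ R_tor — the one weight-4 relation not generated
by finite double shuffle and duality; through ToricSound and CubicalCoordinates a toric chain here
also closes StandardParts.SpHoffmanWeightFour and the s = (3) instance of
CoactionDevissage.HoffmanRegularisation. [deps: DualityWeightThreeToric] [difficulty: L] -/
@[route_item "route-KontsevichZagierPeriods-ToricCore"]
def HoffmanWeightFourToric : Prop :=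
  let T : AddSubgroup Literature.NumberTheory.Transcendental.KZ.FormalRep := AddSubgroup.closure {c | ∃ (n N M K : ℕ) (r : Literature.NumberTheory.Transcendental.KZ.IntegralRep n) (g : Fin N → (Fin n → ℝ) → ℝ) (h : Fin M → (Fin n → ℝ) → ℝ) (d : Fin K → (Fin n → ℝ) → ℝ) (P : MvPolynomial (Fin n) ℚ), (∀ f ∈ Set.range g ∪ Set.range h ∪ Set.range d, ∃ (u w : SignType) (a b : Fin n → ℕ), f = fun x => (u : ℝ) * (∏ i, x i ^ a i) + (w : ℝ) * (∏ i, x i ^ b i)) ∧ r.domain = {x | (∀ k, 0 < g k x) ∧ ∀ k, 0 ≤ h k x} ∧ Set.EqOn r.integrand (fun x => MvPolynomial.aeval x P / ∏ k, d k x) r.domain ∧ c = Literature.NumberTheory.Transcendental.KZ.of r}; let R : AddSubgroup Literature.NumberTheory.Transcendental.KZ.FormalRep := AddSubgroup.closure (((Literature.NumberTheory.Transcendental.KZ.domainAddRel ∪ Literature.NumberTheory.Transcendental.KZ.integrandAddRel ∪ Literature.NumberTheory.Transcendental.KZ.newtonLeibnizRel) ∩ (T : Set Literature.NumberTheory.Transcendental.KZ.FormalRep))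 ∪ {c | ∃ (n : ℕ) (r r' : Literature.NumberTheory.Transcendental.KZ.IntegralRep n) (A : Matrix (Fin n) (Fin n) ℤ), Literature.NumberTheory.Transcendental.KZ.of r ∈ T ∧ Literature.NumberTheory.Transcendental.KZ.of r' ∈ T ∧ A.det ≠ 0 ∧ (∀ x ∈ r.domain, ∀ i, 0 < x i) ∧ r'.domain = (fun x i => ∏ j, x j ^ A i j) '' r.domain ∧ (∀ x ∈ r.domain, r.integrand x = r'.integrand (fun i => ∏ j, x j ^ A i j) * (|(A.det : ℝ)| * (∏ i, ∏ j, x j ^ A i j) / ∏ j, x j)) ∧ c = Literature.NumberTheory.Transcendental.KZ.of r - Literature.NumberTheory.Transcendental.KZ.of r'}); ∀ (r₄ r₃₁ r₂₂ : Literature.NumberTheory.Transcendental.KZ.IntegralRep 4), r₄.domain = {x | ∀ i, 0 < x i ∧ x i < 1} → Set.EqOn r₄.integrand (fun x => 1 / (1 - x 0 * x 1 * x 2 * x 3)) r₄.domain → r₃₁.domain = {x | ∀ i, 0 < x i ∧ x i < 1} → Set.EqOn r₃₁.integrand (fun x => x 0 * x 1 * x 2 / ((1 - x 0 * x 1 *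 x 2) * (1 - x 0 * x 1 * x 2 * x 3))) r₃₁.domain → r₂₂.domain = {x | ∀ i, 0 < x i ∧ x i < 1} → Set.EqOn r₂₂.integrand (fun x => x 0 * x 1 / ((1 - x 0 * x 1) * (1 - x 0 * x 1 * x 2 * x 3))) r₂₂.domain → Literature.NumberTheory.Transcendental.KZ.of r₄ - Literature.NumberTheory.Transcendental.KZ.of r₃₁ - Literature.NumberTheory.Transcendental.KZ.of r₂₂ ∈ R

/-- item stmt-KontsevichZagierPeriods-7837 · crux · rank 5 · open · by planner
why it might fail: It carries the whole non-mixed-Tate part of Conjecture 1 (elliptic/CM periods, Legendre's relation, Gamma values): summit-implied (t := 0) but, given ToricKernel, equivalent to the summit off the conical sector; no toric engine reaches it and route Neg's witnesses would live there.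
sources: KontsevichZagier2001, HuberMullerStach2017, Ayoub2014
[crux] every vanishing formal combination c (KZ.eval c = 0) is congruent modulo KZ.relations to an
element of the toric span T. Summit-implied (t := 0); given ToricKernel it is exactly Conjecture 1
off the conical sector — the honest remainder, split off by SECTOR so that the assembly is pure
logic. [difficulty: open-problem] -/
@[route_item "route-KontsevichZagierPeriods-ToricCore", crux]
def ToricCofinality : Prop :=
  let T : AddSubgroup Literature.NumberTheory.Transcendental.KZ.FormalRep := AddSubgroup.closure {c | ∃ (n N M K : ℕ) (r : Literature.NumberTheory.Transcendental.KZ.IntegralRep n) (g : Fin N → (Fin n → ℝ) → ℝ) (h : Fin M → (Fin n → ℝ) → ℝ) (d : Fin K → (Fin n → ℝ) → ℝ) (P : MvPolynomial (Fin n) ℚ), (∀ f ∈ Set.range g ∪ Set.range h ∪ Set.range d, ∃ (u w : SignType) (a b : Fin n → ℕ), f = fun x => (u : ℝ) * (∏ i, x i ^ a i) + (w : ℝ) * (∏ i, x i ^ b i)) ∧ r.domain = {x | (∀ k, 0 < g k x) ∧ ∀ k, 0 ≤ h k x} ∧ Set.EqOn r.integrand (fun x => MvPolynomial.aeval x P /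 ∏ k, d k x) r.domain ∧ c = Literature.NumberTheory.Transcendental.KZ.of r}; ∀ c : Literature.NumberTheory.Transcendental.KZ.FormalRep, Literature.NumberTheory.Transcendental.KZ.eval c = 0 → ∃ t ∈ T, c - t ∈ Literature.NumberTheory.Transcendental.KZ.relations

-- earlier FiniteStuffleToric (stmt-KontsevichZagierPeriods-7840, replaced 2026-08-15T16:37:21Z -> stmt-KontsevichZagierPeriods-11013): retired by None — let T : AddSubgroup Literature.NumberTheory.Transcendental.KZ.FormalRep := AddSubgroup.closure {c | ∃ (n N M K : ℕ) (r : Literature.NumberTheory.Transcendental.KZ.IntegralRep n) (g : Fin N → (Fin n → ℝ) → ℝ) (h : Fin M → (Fin n → ℝ) → ℝ) (d : Fin K 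
/-- item stmt-KontsevichZagierPeriods-11013 · support · rank 9 · open · by planner
sources: Hoffman1997, Souderes2010, arXiv:0808.0248, GuoPaychaZhang2014
[support] (card T2, product-free form) for admissible s, t and EVERY representation p on the product
cell Δ_s × Δ_t (first weight-s block in the open ordered simplex Δ_s, last weight-t block in Δ_t —
`KZ.IntegralRep.prodDomain` spelled out) whose integrand agrees on it with f_s ⊗ f_t = mzvIntegrand
s (first block) · mzvIntegrand t (last block) (`prodFun` spelled out): [p] − Σ_(u ∈ stuffle s t)
[mzvRep u] ∈ R_tor. The KZProduct representation (mzvRep s).prod (mzvRep t), i.e. [mzvRep s]·[mzvRep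
t], is such a p (prod_integrand_of + prodFunSemialgebraic_holds), so this is the old statement
uniformly in p and the route no longer imports KZProduct. Proof plan unchanged: cubical coordinates
on both blocks (block-diagonal monomial map), the order-type partial fraction 1/((1−X)(1−Y)) =
1/(1−XY) + X/((1−X)(1−XY)) + Y/((1−Y)(1−XY)) iterated along Hoffman's recursion, block permutations.
Strengthens CoactionDevissage.Stuffle through ToricSound. [difficulty: L] [Hoffman1997,
Souderes2010, arXiv:0808.0248, GuoPaychaZhang2014] -/
@[route_item "route-KontsevichZagierPeriods-ToricCore"]
def FiniteStuffleToric : Prop :=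
  let T : AddSubgroup Literature.NumberTheory.Transcendental.KZ.FormalRep := AddSubgroup.closure {c | ∃ (n N M K : ℕ) (r : Literature.NumberTheory.Transcendental.KZ.IntegralRep n) (g : Fin N → (Fin n → ℝ) → ℝ) (h : Fin M → (Fin n → ℝ) → ℝ) (d : Fin K → (Fin n → ℝ) → ℝ) (P : MvPolynomial (Fin n) ℚ), (∀ f ∈ Set.range g ∪ Set.range h ∪ Set.range d, ∃ (u w : SignType) (a b : Fin n → ℕ), f = fun x => (u : ℝ) * (∏ i, x i ^ a i) + (w : ℝ) * (∏ i, x i ^ b i)) ∧ r.domain = {x | (∀ k, 0 < g k x) ∧ ∀ k, 0 ≤ h k x} ∧ Set.EqOn r.integrand (fun x => MvPolynomial.aeval x P / ∏ k, d k x) r.domain ∧ c = Literature.NumberTheory.Transcendental.KZ.of r}; let R : AddSubgroup Literature.NumberTheory.Transcendental.KZ.FormalRep := AddSubgroup.closure (((Literature.NumberTheory.Transcendental.KZ.domainAddRel ∪ Literature.NumberTheory.Transcendental.KZ.integrandAddRel ∪ Literature.NumberTheory.Transcendental.KZ.newtonLeibnizRel) ∩ (T : Set Literature.NumberTheory.Transcendental.KZ.FormalRep))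 ∪ {c | ∃ (n : ℕ) (r r' : Literature.NumberTheory.Transcendental.KZ.IntegralRep n) (A : Matrix (Fin n) (Fin n) ℤ), Literature.NumberTheory.Transcendental.KZ.of r ∈ T ∧ Literature.NumberTheory.Transcendental.KZ.of r' ∈ T ∧ A.det ≠ 0 ∧ (∀ x ∈ r.domain, ∀ i, 0 < x i) ∧ r'.domain = (fun x i => ∏ j, x j ^ A i j) '' r.domain ∧ (∀ x ∈ r.domain, r.integrand x = r'.integrand (fun i => ∏ j, x j ^ A i j) * (|(A.det : ℝ)| * (∏ i, ∏ j, x j ^ A i j) / ∏ j, x j)) ∧ c = Literature.NumberTheory.Transcendental.KZ.of r - Literature.NumberTheory.Transcendental.KZ.of r'}); let ρ : List ℕ → Literature.NumberTheory.Transcendental.KZ.FormalRep := fun u => if hu : Literature.NumberTheory.Transcendental.MZV.IsAdmissible u then Literature.NumberTheory.Transcendental.KZ.of (Literature.NumberTheory.Transcendental.KZ.mzvRep u hu (Literature.NumberTheory.Transcendental.KZ.mzvIntegrand_isSemialgebraicFunOn_holds u) (Literature.NumberTheory.Transcendental.KZ.mzvIntegrand_integrableOn_holds u hu)) else 0; ∀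 s t : List ℕ, Literature.NumberTheory.Transcendental.MZV.IsAdmissible s → Literature.NumberTheory.Transcendental.MZV.IsAdmissible t → ∀ p : Literature.NumberTheory.Transcendental.KZ.IntegralRep (Literature.NumberTheory.Transcendental.MZV.weight s + Literature.NumberTheory.Transcendental.MZV.weight t), p.domain = {z | (fun i => z (Fin.castAdd (Literature.NumberTheory.Transcendental.MZV.weight t) i)) ∈ Literature.NumberTheory.Transcendental.KZ.openOrderedSimplex (Literature.NumberTheory.Transcendental.MZV.weight s) ∧ (fun j => z (Fin.natAdd (Literature.NumberTheory.Transcendental.MZV.weight s) j)) ∈ Literature.NumberTheory.Transcendental.KZ.openOrderedSimplex (Literature.NumberTheory.Transcendental.MZV.weight t)} → Set.EqOn p.integrand (fun z => Literature.NumberTheory.Transcendental.KZ.mzvIntegrand s (fun i => z (Fin.castAdd (Literature.NumberTheory.Transcendental.MZV.weight t) i)) * Literature.NumberTheory.Transcendental.KZ.mzvIntegrand t (fun j => z (Fin.natAdd (Literature.NumberTheory.Transcendental.MZV.weight s) j))) p.domain → Literature.NumberTheory.Transcendental.KZ.of p - ((Literature.NumberTheory.Transcendental.MZV.stuffle s t).map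 ρ).sum ∈ R

-- earlier FiniteShuffleToric (stmt-KontsevichZagierPeriods-7841, replaced 2026-08-15T16:37:21Z -> stmt-KontsevichZagierPeriods-11014): retired by None — let T : AddSubgroup Literature.NumberTheory.Transcendental.KZ.FormalRep := AddSubgroup.closure {c | ∃ (n N M K : ℕ) (r : Literature.NumberTheory.Transcendental.KZ.IntegralRep n) (g : Fin N → (Fin n → ℝ) → ℝ) (h : Fin M → (Fin n → ℝ) → ℝ) (d : Fin K 
/-- item stmt-KontsevichZagierPeriods-11014 · support · rank 9 · open · by planner
sources: arXiv:0808.0248, BrownCarrSchneps2010, KontsevichZagier2001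
[support] (product-free form) for admissible s, t and EVERY representation p on the product cell Δ_s
× Δ_t (blocks as in FiniteStuffleToric) whose integrand agrees on it with f_s ⊗ f_t: [p] − Σ_(w ∈
sh(word s, word t)) [mzvRep (index of w)] ∈ R_tor — the product cell is a binomial cell, its
dissection into the simplices indexed by shuffles is by binomial cuts tᵢ ≶ s_j (pairwise overlaps
null) and the identifications are coordinate permutations. [mzvRep s]·[mzvRep t] of KZProduct is
such a p, so this is the old statement uniformly in p. Strengthens CoactionDevissage.Shuffle; with
FiniteStuffleToric it puts Grothendieck 0275 (ζ(4) = 4ζ(3,1)) inside R_tor. [difficulty: L]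
[arXiv:0808.0248, BrownCarrSchneps2010, KontsevichZagier2001] -/
@[route_item "route-KontsevichZagierPeriods-ToricCore"]
def FiniteShuffleToric : Prop :=
  let T : AddSubgroup Literature.NumberTheory.Transcendental.KZ.FormalRep := AddSubgroup.closure {c | ∃ (n N M K : ℕ) (r : Literature.NumberTheory.Transcendental.KZ.IntegralRep n) (g : Fin N → (Fin n → ℝ) → ℝ) (h : Fin M → (Fin n → ℝ) → ℝ) (d : Fin K → (Fin n → ℝ) → ℝ) (P : MvPolynomial (Fin n) ℚ), (∀ f ∈ Set.range g ∪ Set.range h ∪ Set.range d, ∃ (u w : SignType) (a b : Fin n → ℕ), f = fun x => (u : ℝ) * (∏ i, x i ^ a i) + (w : ℝ) * (∏ i, x i ^ b i)) ∧ r.domain = {x | (∀ k, 0 < g k x) ∧ ∀ k, 0 ≤ h k x} ∧ Set.EqOn r.integrand (fun x => MvPolynomial.aeval x P / ∏ k, d k x) r.domain ∧ c = Literature.NumberTheory.Transcendental.KZ.of r}; let R : AddSubgroup Literature.NumberTheory.Transcendental.KZ.FormalRep := AddSubgroup.closure (((Literature.NumberTheory.Transcendental.KZ.domainAddRel ∪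 Literature.NumberTheory.Transcendental.KZ.integrandAddRel ∪ Literature.NumberTheory.Transcendental.KZ.newtonLeibnizRel) ∩ (T : Set Literature.NumberTheory.Transcendental.KZ.FormalRep)) ∪ {c | ∃ (n : ℕ) (r r' : Literature.NumberTheory.Transcendental.KZ.IntegralRep n) (A : Matrix (Fin n) (Fin n) ℤ), Literature.NumberTheory.Transcendental.KZ.of r ∈ T ∧ Literature.NumberTheory.Transcendental.KZ.of r' ∈ T ∧ A.det ≠ 0 ∧ (∀ x ∈ r.domain, ∀ i, 0 < x i) ∧ r'.domain = (fun x i => ∏ j, x j ^ A i j) '' r.domain ∧ (∀ x ∈ r.domain, r.integrand x = r'.integrand (fun i => ∏ j, x j ^ A i j) * (|(A.det : ℝ)| * (∏ i, ∏ j, x j ^ A i j) / ∏ j, x j)) ∧ c = Literature.NumberTheory.Transcendental.KZ.of r - Literature.NumberTheory.Transcendental.KZ.of r'}); let ρ : List ℕ → Literature.NumberTheory.Transcendental.KZ.FormalRep := fun u => if hu : Literature.NumberTheory.Transcendental.MZV.IsAdmissible u then Literature.NumberTheory.Transcendental.KZ.of (Literature.NumberTheory.Transcendental.KZ.mzvRep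 u hu (Literature.NumberTheory.Transcendental.KZ.mzvIntegrand_isSemialgebraicFunOn_holds u) (Literature.NumberTheory.Transcendental.KZ.mzvIntegrand_integrableOn_holds u hu)) else 0; ∀ s t : List ℕ, Literature.NumberTheory.Transcendental.MZV.IsAdmissible s → Literature.NumberTheory.Transcendental.MZV.IsAdmissible t → ∀ p : Literature.NumberTheory.Transcendental.KZ.IntegralRep (Literature.NumberTheory.Transcendental.MZV.weight s + Literature.NumberTheory.Transcendental.MZV.weight t), p.domain = {z | (fun i => z (Fin.castAdd (Literature.NumberTheory.Transcendental.MZV.weight t) i)) ∈ Literature.NumberTheory.Transcendental.KZ.openOrderedSimplex (Literature.NumberTheory.Transcendental.MZV.weight s) ∧ (fun j => z (Fin.natAdd (Literature.NumberTheory.Transcendental.MZV.weight s) j)) ∈ Literature.NumberTheory.Transcendental.KZ.openOrderedSimplex (Literature.NumberTheory.Transcendental.MZV.weight t)} → Set.EqOn p.integrand (fun z => Literature.NumberTheory.Transcendental.KZ.mzvIntegrand s (fun i => z (Fin.castAdd (Literature.NumberTheory.Transcendental.MZV.weight t) i)) * Literature.NumberTheory.Transcendental.KZ.mzvIntegrand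 t (fun j => z (Fin.natAdd (Literature.NumberTheory.Transcendental.MZV.weight s) j))) p.domain → Literature.NumberTheory.Transcendental.KZ.of p - ((Literature.NumberTheory.Transcendental.MZV.shuffleWord (Literature.NumberTheory.Transcendental.MZV.binaryWord s) (Literature.NumberTheory.Transcendental.MZV.binaryWord t)).map fun w => ρ (Literature.NumberTheory.Transcendental.MZV.ofBinaryWord w)).sum ∈ R

/-- item stmt-KontsevichZagierPeriods-7838 · support · rank 9 · closed · proved by Summit.KontsevichZagierPeriods.ToricCore.tornheimToric_proof @ 37eb91a48d14 (prover) · by planner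
sources: Tornheim1950, BorweinBradley2006, KontsevichZagier2001
[support] (card T1) W(1,1,1) = Σ 1/(mn(m+n)) as S = [□³, x₂/((1−x₀x₂)(1−x₁x₂))] satisfies [S] −
2·[Z₂₁] ∈ R_tor with Z₂₁ = [□³, x₀x₁/((1−x₀x₁)(1−x₀x₁x₂))] (= ζ(2,1)): one binomial cut □³ = {x₀<x₁}
⊔ {x₁≤x₀} (the diagonal is a null toric cell, removable inside R_tor by the r = r ∪ r instance of
(1a)), the monomial maps (y₀,y₁,y₂) ↦ (y₀y₁, y₁, y₂) resp. (y₀, y₀y₁, y₂) (det 1, Jacobian y₁ resp.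
y₀) and a coordinate permutation; integrands transform exactly (checked by hand and by series).
Calibration of the inline encoding: prove first. [difficulty: provable-now] -/
@[route_item "route-KontsevichZagierPeriods-ToricCore"]
def TornheimToric : Prop :=
  let T : AddSubgroup Literature.NumberTheory.Transcendental.KZ.FormalRep := AddSubgroup.closure {c | ∃ (n N M K : ℕ) (r : Literature.NumberTheory.Transcendental.KZ.IntegralRep n) (g : Fin N → (Fin n → ℝ) → ℝ) (h : Fin M → (Fin n → ℝ) → ℝ) (d : Fin K → (Fin n → ℝ) → ℝ) (P : MvPolynomial (Fin n) ℚ), (∀ f ∈ Set.range g ∪ Set.range h ∪ Set.range d, ∃ (u w : SignType) (a b : Fin n → ℕ), f = fun x => (u : ℝ) * (∏ i, x i ^ a i) + (w : ℝ) * (∏ i, x i ^ b i)) ∧ r.domain = {x | (∀ k, 0 < g k x) ∧ ∀ k, 0 ≤ h k x} ∧ Set.EqOn r.integrand (fun x => MvPolynomial.aeval x P / ∏ k, d k x) r.domain ∧ c = Literature.NumberTheory.Transcendental.KZ.of r}; let R : AddSubgroup Literature.NumberTheory.Transcendental.KZ.FormalRep := AddSubgroup.closure (((Literature.NumberTheory.Transcendental.KZ.domainAddRel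 ∪ Literature.NumberTheory.Transcendental.KZ.integrandAddRel ∪ Literature.NumberTheory.Transcendental.KZ.newtonLeibnizRel) ∩ (T : Set Literature.NumberTheory.Transcendental.KZ.FormalRep)) ∪ {c | ∃ (n : ℕ) (r r' : Literature.NumberTheory.Transcendental.KZ.IntegralRep n) (A : Matrix (Fin n) (Fin n) ℤ), Literature.NumberTheory.Transcendental.KZ.of r ∈ T ∧ Literature.NumberTheory.Transcendental.KZ.of r' ∈ T ∧ A.det ≠ 0 ∧ (∀ x ∈ r.domain, ∀ i, 0 < x i) ∧ r'.domain = (fun x i => ∏ j, x j ^ A i j) '' r.domain ∧ (∀ x ∈ r.domain, r.integrand x = r'.integrand (fun i => ∏ j, x j ^ A i j) * (|(A.det : ℝ)| * (∏ i, ∏ j, x j ^ A i j) / ∏ j, x j)) ∧ c = Literature.NumberTheory.Transcendental.KZ.of r - Literature.NumberTheory.Transcendental.KZ.of r'}); ∀ (r r' : Literature.NumberTheory.Transcendental.KZ.IntegralRep 3), r.domain = {x | ∀ i, 0 < x i ∧ x i < 1} → Set.EqOn r.integrand (fun x => x 2 / ((1 - x 0 * x 2) * (1 - x 1 * x 2)))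 r.domain → r'.domain = {x | ∀ i, 0 < x i ∧ x i < 1} → Set.EqOn r'.integrand (fun x => x 0 * x 1 / ((1 - x 0 * x 1) * (1 - x 0 * x 1 * x 2))) r'.domain → Literature.NumberTheory.Transcendental.KZ.of r - 2 • Literature.NumberTheory.Transcendental.KZ.of r' ∈ R

/-- item stmt-KontsevichZagierPeriods-7839 · support · rank 9 · closed · proved by Summit.KontsevichZagierPeriods.ToricCore.cubicalCoordinates_proof @ 4c2fe4a0e4ba (prover) · by planner
sources: arXiv:0808.0248, Souderes2010, Brown2012, KontsevichZagier2001
[support] the simplex representation is toric-equivalent to its cubical form: for admissible s of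
weight w and any rep r on the open cube □^w with integrand mzvIntegrand s (x₀, x₀x₁, …, x₀⋯x_(w−1))
· ∏_j x_j^(w−1−j), [mzvRep s] − [r] ∈ R_tor — ONE monomial change of variables (A_ij = 1 for j ≤ i,
det 1, image of □^w = the open ordered simplex, Jacobian ∏_j x_j^(w−1−j)); both representations are
toric as data (StrictAnti ⟺ finitely many binomial inequalities; ∏ ω_ε = 1/∏(signed binomials)).
[difficulty: provable-now] -/
@[route_item "route-KontsevichZagierPeriods-ToricCore"]
def CubicalCoordinates : Prop :=
  let T : AddSubgroup Literature.NumberTheory.Transcendental.KZ.FormalRep := AddSubgroup.closure {c | ∃ (n N M K : ℕ) (r : Literature.NumberTheory.Transcendental.KZ.IntegralRep n) (g : Fin N → (Fin n → ℝ) → ℝ) (h : Fin M → (Fin n → ℝ) → ℝ) (d : Fin K → (Fin n → ℝ) → ℝ) (P : MvPolynomial (Fin n) ℚ), (∀ f ∈ Set.range g ∪ Set.range h ∪ Set.range d, ∃ (u w : SignType) (a b : Fin n → ℕ), f = fun x => (u : ℝ) * (∏ i, x i ^ a i) + (w : ℝ) * (∏ i, x i ^ b i)) ∧ r.domain = {x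 | (∀ k, 0 < g k x) ∧ ∀ k, 0 ≤ h k x} ∧ Set.EqOn r.integrand (fun x => MvPolynomial.aeval x P / ∏ k, d k x) r.domain ∧ c = Literature.NumberTheory.Transcendental.KZ.of r}; let R : AddSubgroup Literature.NumberTheory.Transcendental.KZ.FormalRep := AddSubgroup.closure (((Literature.NumberTheory.Transcendental.KZ.domainAddRel ∪ Literature.NumberTheory.Transcendental.KZ.integrandAddRel ∪ Literature.NumberTheory.Transcendental.KZ.newtonLeibnizRel) ∩ (T : Set Literature.NumberTheory.Transcendental.KZ.FormalRep)) ∪ {c | ∃ (n : ℕ) (r r' : Literature.NumberTheory.Transcendental.KZ.IntegralRep n) (A : Matrix (Fin n) (Fin n) ℤ), Literature.NumberTheory.Transcendental.KZ.of r ∈ T ∧ Literature.NumberTheory.Transcendental.KZ.of r' ∈ T ∧ A.det ≠ 0 ∧ (∀ x ∈ r.domain, ∀ i, 0 < x i) ∧ r'.domain = (fun x i => ∏ j, x j ^ A i j) '' r.domain ∧ (∀ x ∈ r.domain, r.integrand x = r'.integrand (fun i => ∏ j, x j ^ A i j) * (|(A.det : ℝ)| * (∏ i, ∏ j, x j ^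 A i j) / ∏ j, x j)) ∧ c = Literature.NumberTheory.Transcendental.KZ.of r - Literature.NumberTheory.Transcendental.KZ.of r'}); ∀ (s : List ℕ) (hs : Literature.NumberTheory.Transcendental.MZV.IsAdmissible s) (r : Literature.NumberTheory.Transcendental.KZ.IntegralRep (Literature.NumberTheory.Transcendental.MZV.weight s)), r.domain = {x | ∀ i, 0 < x i ∧ x i < 1} → Set.EqOn r.integrand (fun x => Literature.NumberTheory.Transcendental.KZ.mzvIntegrand s (fun i => ∏ j, if j ≤ i then x j else 1) * ∏ j : Fin (Literature.NumberTheory.Transcendental.MZV.weight s), x j ^ (Literature.NumberTheory.Transcendental.MZV.weight s - 1 - (j : ℕ))) r.domain → Literature.NumberTheory.Transcendental.KZ.of (Literature.NumberTheory.Transcendental.KZ.mzvRep s hs (Literature.NumberTheory.Transcendental.KZ.mzvIntegrand_isSemialgebraicFunOn_holds s) (Literature.NumberTheory.Transcendental.KZ.mzvIntegrand_integrableOn_holds s hs)) - Literature.NumberTheory.Transcendental.KZ.of r ∈ R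

/-- item stmt-KontsevichZagierPeriods-7842 · support · rank 9 · closed · proved by Summit.KontsevichZagierPeriods.ToricCore.toricSound_proof @ 026f4191ea7a (prover) · by planner
sources: KontsevichZagier2001, Literature.NumberTheory.Transcendental.KZ.changeOfVariablesRel_subset_relations
[support] R_tor ≤ KZ.relations: the support-toric instances of (1a), (1b), (3) are moves by
definition, and a monomial map x ↦ (∏_j x_j^(A_ij))_i with det A ≠ 0 on a domain inside the open
positive orthant is ℚ-semialgebraic, differentiable and injective with |det D| = |det A|·∏_i(∏_j
x_j^(A_ij))/∏_j x_j, so every monomial instance is a changeOfVariablesRel instance. Makes each toric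
item imply its KZ.relations shadow (e.g. FiniteStuffleToric ⇒ CoactionDevissage.Stuffle,
HoffmanWeightFourToric + CubicalCoordinates ⇒ StandardParts.SpHoffmanWeightFour). [difficulty:
provable-now] -/
@[route_item "route-KontsevichZagierPeriods-ToricCore"]
def ToricSound : Prop :=
  let T : AddSubgroup Literature.NumberTheory.Transcendental.KZ.FormalRep := AddSubgroup.closure {c | ∃ (n N M K : ℕ) (r : Literature.NumberTheory.Transcendental.KZ.IntegralRep n) (g : Fin N → (Fin n → ℝ) → ℝ) (h : Fin M → (Fin n → ℝ) → ℝ) (d : Fin K → (Fin n → ℝ) → ℝ) (P : MvPolynomial (Fin n) ℚ), (∀ f ∈ Set.range g ∪ Set.range h ∪ Set.range d, ∃ (u w : SignType) (a b : Fin n → ℕ), f = fun x => (u : ℝ) * (∏ i, x i ^ a i) + (w : ℝ) * (∏ i, x i ^ b i)) ∧ r.domain = {x | (∀ k, 0 < g k x) ∧ ∀ k, 0 ≤ h k x} ∧ Set.EqOn r.integrand (fun x => MvPolynomial.aeval x P / ∏ k, d k x) r.domain ∧ c = Literature.NumberTheory.Transcendental.KZ.of r}; let R : AddSubgroup Literature.NumberTheory.Transcendental.KZ.FormalRep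 := AddSubgroup.closure (((Literature.NumberTheory.Transcendental.KZ.domainAddRel ∪ Literature.NumberTheory.Transcendental.KZ.integrandAddRel ∪ Literature.NumberTheory.Transcendental.KZ.newtonLeibnizRel) ∩ (T : Set Literature.NumberTheory.Transcendental.KZ.FormalRep)) ∪ {c | ∃ (n : ℕ) (r r' : Literature.NumberTheory.Transcendental.KZ.IntegralRep n) (A : Matrix (Fin n) (Fin n) ℤ), Literature.NumberTheory.Transcendental.KZ.of r ∈ T ∧ Literature.NumberTheory.Transcendental.KZ.of r' ∈ T ∧ A.det ≠ 0 ∧ (∀ x ∈ r.domain, ∀ i, 0 < x i) ∧ r'.domain = (fun x i => ∏ j, x j ^ A i j) '' r.domain ∧ (∀ x ∈ r.domain, r.integrand x = r'.integrand (fun i => ∏ j, x j ^ A i j) * (|(A.det : ℝ)| * (∏ i, ∏ j, x j ^ A i j) / ∏ j, x j)) ∧ c = Literature.NumberTheory.Transcendental.KZ.of r - Literature.NumberTheory.Transcendental.KZ.of r'}); R ≤ Literature.NumberTheory.Transcendental.KZ.relations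

/-- item stmt-KontsevichZagierPeriods-7843 · assembly · rank 1 · closed · proved by Summit.KontsevichZagierPeriods.ToricCore.assembly_proof @ fbd73fb6ceb1 (prover) · by planner
sources: KontsevichZagier2001, HuberMullerStach2017
[assembly] ToricKernel → ToricCofinality → KontsevichZagierPeriods. -/
@[route_item "route-KontsevichZagierPeriods-ToricCore"]
def Assembly : Prop :=
  ToricKernel → ToricCofinality → KontsevichZagierPeriods

/-! D-0027 §2.1 — DECIDING THEOREM (planner-authored via `route open/edit --closes-file`; by planner-rbadge-KontsevichZagierPeriods-ToricCo-64bc641f-g2-0 2026-08-15T16:18:39Z):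
its hypotheses are this route's items and its conclusion the sub-problem Statement (glue_lint), and it elaborates with this file. -/

@[closes "route-KontsevichZagierPeriods-ToricCore"] theorem closes (hK : ToricKernel) (hC : ToricCofinality) : KontsevichZagierPeriods := by
  intro n m r r' _ _ hv
  have hc : Literature.NumberTheory.Transcendental.KZ.eval
      (Literature.NumberTheory.Transcendental.KZ.of r -
        Literature.NumberTheory.Transcendental.KZ.of r') = 0 := by
    simp [Literature.NumberTheory.Transcendental.KZ.eval_of, hv]
  obtain ⟨t, htT, hct⟩ := hC _ hc
  have h1 : Literature.NumberTheory.Transcendental.KZ.eval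
      (Literature.NumberTheory.Transcendental.KZ.of r -
        Literature.NumberTheory.Transcendental.KZ.of r' - t) = 0 :=
    (AddMonoidHom.mem_ker).mp
      (Literature.NumberTheory.Transcendental.KZ.relations_le_ker_eval_holds hct)
  have ht0 : Literature.NumberTheory.Transcendental.KZ.eval t = 0 := by
    rwa [map_sub, hc, zero_sub, neg_eq_zero] at h1
  have ht : t ∈ Literature.NumberTheory.Transcendental.KZ.relations := hK t htT ht0
  have h2 := Literature.NumberTheory.Transcendental.KZ.relations.add_mem hct ht
  rwa [sub_add_cancel] at h2

end Summit.KontsevichZagierPeriods.KontsevichZagierPeriods.Theses.ToricCore
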